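import Literature.AlgebraicGeometry.Resolution.OrderGenerizationCoheightOne
import Literature.AlgebraicGeometry.Resolution.ExcellentRingsFieldProofs
import HarnessLib

/-!
# Generization lowers the order, II: arbitrary primes of a regular local ring

Topic: `Literature/AlgebraicGeometry/Resolution`. **Theorem** (`mem_pow_of_mul_mem_pow`): let
`(R, 𝔪)` be a regular local ring, `P` a prime ideal, `x ∈ R`, and suppose `s x ∈ Pⁿ` for some
`s ∉ P` (equivalently `x/1 ∈ (PR_P)ⁿ`, `mem_pow_of_algebraMap_mem_pow`). Then `x ∈ 𝔪ⁿ`. In words: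
for an ideal `J` of a regular local ring, `ord_P(J) ≤ ord_𝔪(J)` for every prime `P` — the order
does not increase under generization, i.e. the sets `{ord ≥ n}` are stable under specialization.
This is the pointwise part of "`Σ := {x ∈ X | m(x) = μ}` … is a closed subset of `X`" in the proof
of Cossart–Piltant 2008, Prop. 4.2; for regular local rings it holds without any excellence
hypothesis (it is the local form of Zariski's `P⁽ⁿ⁾ ⊆ 𝔪ⁿ`).

## Proof

For primes `P ≤ Q` put `Φ(P, Q)`: "`s x ∈ Pⁿ`, `s ∉ P` ⟹ `u x ∈ Qⁿ` for some `u ∉ Q`". `Φ` is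
transitive, and holds when `Q` covers `P` by the coheight-one case
(`OrderGenerizationCoheightOne.lean`) applied to the regular local ring `R_Q` and its prime `PR_Q`
of coheight one (`ringKrullDim_localization_quotient_eq_one_of_covBy`). A saturated chain of primes
from `P` to `𝔪` (`exists_isSaturated_ltSeries_of_krullDim_lt_top`) then gives `Φ(P, 𝔪)`.

## References

* V. Cossart, O. Piltant, J. Algebra 320 (2008), proof of Prop. 4.2. [cite: CossartPiltant2008, Prop. 4.2 (proof)]
-/

noncomputable section

open IsLocalRing Order

namespace Literature.AlgebraicGeometry.Resolution

universe u

section Covering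

variable {R : Type u} [CommRing R] {P Q : Ideal R} [P.IsPrime] [Q.IsPrime]

omit [P.IsPrime] in
/-- For primes `P ≤ Q`, the multiplicative set `R ∖ Q` misses `P`. [folklore] -/
theorem disjoint_primeCompl_of_le (hPQ : P ≤ Q) : Disjoint (Q.primeCompl : Set R) P :=
  Set.disjoint_left.mpr fun _ hr hrP => hr (hPQ hrP)

/-- **If `Q` covers `P` in `Spec R` then `dim R_Q/PR_Q = 1`**: the primes of `R_Q/PR_Q` correspond
to the primes of `R` between `P` and `Q`, i.e. to `P` and `Q` only. [folklore] -/
theorem ringKrullDim_localization_quotient_eq_one_of_covBy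
    (hcov : (⟨P, ‹_›⟩ : PrimeSpectrum R) ⋖ ⟨Q, ‹_›⟩) :
    haveI := IsLocalization.isPrime_of_isPrime_disjoint Q.primeCompl (Localization.AtPrime Q) P
      ‹_› (disjoint_primeCompl_of_le hcov.le)
    ringKrullDim (Localization.AtPrime Q ⧸ P.map (algebraMap R (Localization.AtPrime Q))) = 1 := by
  have hPQ : P ≤ Q := hcov.le
  set RQ := Localization.AtPrime Q with hRQ
  set P' := P.map (algebraMap R RQ) with hP'
  haveI hP'p : P'.IsPrime :=
    IsLocalization.isPrime_of_isPrime_disjoint Q.primeCompl RQ P ‹_› (disjoint_primeCompl_of_le hPQ)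
  have hP'u : P'.under R = P :=
    IsLocalization.under_map_of_isPrime_disjoint Q.primeCompl RQ ‹_› (disjoint_primeCompl_of_le hPQ)
  haveI : IsLocalRing (RQ ⧸ P') :=
    IsLocalRing.of_surjective' (Ideal.Quotient.mk P') Ideal.Quotient.mk_surjective
  have hmT : (maximalIdeal RQ).map (Ideal.Quotient.mk P') = maximalIdeal (RQ ⧸ P') :=
    IsLocalRing.map_maximalIdeal_of_surjective _ Ideal.Quotient.mk_surjective
  have hmQ : maximalIdeal RQ = Q.map (algebraMap R RQ) :=
    (IsLocalization.AtPrime.map_eq_maximalIdeal Q RQ).symm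
  refine le_antisymm ?_ ?_
  · -- every non-zero prime of `R_Q/PR_Q` is maximal
    haveI : Ring.KrullDimLE 1 (RQ ⧸ P') := by
      refine Ring.krullDimLE_one_iff_of_noZeroDivisors.mpr fun 𝔯 hne h𝔯 => ?_
      let 𝔯₁ : Ideal RQ := 𝔯.comap (Ideal.Quotient.mk P')
      let 𝔮 : PrimeSpectrum R := ⟨𝔯₁.under R, inferInstance⟩
      have hP𝔮 : (⟨P, ‹_›⟩ : PrimeSpectrum R) ≤ 𝔮 := by
        change P ≤ 𝔯₁.under R
        rw [← hP'u]
        exact Ideal.comap_mono (Ideal.mk_ker.symm.trans_le (Ideal.comap_mono bot_le))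
      have h𝔮Q : 𝔮 ≤ (⟨Q, ‹_›⟩ : PrimeSpectrum R) := by
        change 𝔯₁.under R ≤ Q
        have h1 : 𝔯₁ ≤ maximalIdeal RQ := IsLocalRing.le_maximalIdeal (Ideal.IsPrime.ne_top inferInstance)
        have h2 := Ideal.comap_mono (f := algebraMap R RQ) h1
        rwa [hmQ, ← Ideal.under_def, ← Ideal.under_def,
          IsLocalization.under_map_of_isPrime_disjoint Q.primeCompl RQ ‹Q.IsPrime›
            (disjoint_primeCompl_of_le le_rfl)] at h2
      have h𝔯₁ : (𝔯₁.under R).map (algebraMap R RQ) = 𝔯₁ := IsLocalization.map_under Q.primeCompl RQ 𝔯₁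
      have h𝔯 : 𝔯₁.map (Ideal.Quotient.mk P') = 𝔯 := Ideal.map_comap_of_surjective _ Ideal.Quotient.mk_surjective 𝔯
      rcases hcov.eq_or_eq hP𝔮 h𝔮Q with h | h
      · -- `𝔮 = P`: then `𝔯 = ⊥`
        exfalso; apply hne
        have h𝔮P : 𝔯₁.under R = P := congrArg PrimeSpectrum.asIdeal h
        rw [← h𝔯, ← h𝔯₁, h𝔮P, ← hP', Ideal.map_eq_bot_iff_le_ker, Ideal.mk_ker]
      · -- `𝔮 = Q`: then `𝔯` is the maximal ideal
        have h𝔮Q' : 𝔯₁.under R = Q := congrArg PrimeSpectrum.asIdeal h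
        have : 𝔯 = maximalIdeal (RQ ⧸ P') := by rw [← h𝔯, ← h𝔯₁, h𝔮Q', ← hmQ, hmT]
        rw [this]; exact IsLocalRing.maximalIdeal.isMaximal _
    exact Ring.krullDimLE_iff.mp inferInstance
  · -- the maximal ideal of `R_Q/PR_Q` is non-zero since `P ≠ Q`
    have hne : maximalIdeal (RQ ⧸ P') ≠ ⊥ := by
      intro hbot
      rw [← hmT, Ideal.map_eq_bot_iff_le_ker, Ideal.mk_ker, hmQ] at hbot
      have := Ideal.comap_mono (f := algebraMap R RQ) hbot
      rw [← Ideal.under_def, ← Ideal.under_def, hP'u,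
        IsLocalization.under_map_of_isPrime_disjoint Q.primeCompl RQ ‹Q.IsPrime›
          (disjoint_primeCompl_of_le le_rfl)] at this
      exact hcov.lt.ne (PrimeSpectrum.ext (le_antisymm hPQ this))
    rw [← IsLocalRing.maximalIdeal_height_eq_ringKrullDim]
    have h0 : (maximalIdeal (RQ ⧸ P')).height ≠ 0 := by
      rw [Ne, Ideal.height_eq_zero_iff, IsDomain.minimalPrimes_eq_singleton_bot,
        Set.mem_singleton_iff]
      exact hne
    exact_mod_cast Order.one_le_iff_ne_zero.mpr h0

/-- **The covering step**: if `Q` covers `P` and `s x ∈ Pⁿ` with `s ∉ P`, then `u x ∈ Qⁿ` for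
some `u ∉ Q` (the coheight-one theorem in the regular local ring `R_Q`).
[cite: CossartPiltant2008, Prop. 4.2 (proof)] -/
theorem exists_mul_mem_pow_of_covBy [IsRegularLocalRing R]
    (hcov : (⟨P, ‹_›⟩ : PrimeSpectrum R) ⋖ ⟨Q, ‹_›⟩) {n : ℕ} {x s : R} (hs : s ∉ P)
    (hsx : s * x ∈ P ^ n) : ∃ u ∉ Q, u * x ∈ Q ^ n := by
  have hPQ : P ≤ Q := hcov.le
  haveI : IsDomain R := isDomain_of_isRegularLocalRing R
  haveI : IsRegularLocalRing (Localization.AtPrime Q) := isRegularLocalRing_localization_atPrime R Q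
  haveI hP'p : (P.map (algebraMap R (Localization.AtPrime Q))).IsPrime :=
    IsLocalization.isPrime_of_isPrime_disjoint Q.primeCompl _ P ‹_› (disjoint_primeCompl_of_le hPQ)
  have hdim := ringKrullDim_localization_quotient_eq_one_of_covBy hcov
  have hs' : algebraMap R (Localization.AtPrime Q) s ∉ P.map (algebraMap R (Localization.AtPrime Q)) := by
    intro h
    apply hs
    have : s ∈ (P.map (algebraMap R (Localization.AtPrime Q))).under R := h
    rwa [IsLocalization.under_map_of_isPrime_disjoint Q.primeCompl (Localization.AtPrime Q) ‹_›
      (disjoint_primeCompl_of_le hPQ)] at this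
  have hsx' : algebraMap R (Localization.AtPrime Q) s * algebraMap R _ x ∈
      P.map (algebraMap R (Localization.AtPrime Q)) ^ n := by
    rw [← map_mul, ← Ideal.map_pow]
    exact Ideal.mem_map_of_mem _ hsx
  have hmem := mem_pow_of_coheight_one (P.map (algebraMap R (Localization.AtPrime Q))) hdim hs' hsx'
  exact exists_mul_mem_pow_of_algebraMap_mem_maximalIdeal_pow Q (Localization.AtPrime Q) hmem

end Covering

/-- **Generization lowers the order.** Let `R` be a regular local ring, `P` a prime ideal and
suppose `s x ∈ Pⁿ` for some `s ∉ P` (i.e. `x ∈ PⁿR_P ∩ R`). Then `x ∈ 𝔪ⁿ`.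
[cite: CossartPiltant2008, Prop. 4.2 (proof)] -/
theorem mem_pow_of_mul_mem_pow {R : Type u} [CommRing R] [IsRegularLocalRing R] (P : Ideal R)
    [P.IsPrime] {n : ℕ} {x s : R} (hs : s ∉ P) (hsx : s * x ∈ P ^ n) : x ∈ maximalIdeal R ^ n := by
  -- a saturated chain of primes from `P` to `𝔪`
  have hfin : krullDim (PrimeSpectrum R) < ⊤ := ringKrullDim_lt_top
  obtain ⟨c, hhead, hlast, hsat⟩ := exists_isSaturated_ltSeries_of_krullDim_lt_top hfin
    (p := (⟨P, ‹_›⟩ : PrimeSpectrum R)) (q := ⟨maximalIdeal R, inferInstance⟩)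
    (IsLocalRing.le_maximalIdeal (Ideal.IsPrime.ne_top ‹_›))
  -- propagate along the chain
  have key : ∀ i : Fin (c.length + 1), ∃ u ∉ (c i).asIdeal, u * x ∈ (c i).asIdeal ^ n := by
    intro i
    induction i using Fin.induction with
    | zero =>
      have h0 : c 0 = ⟨P, ‹_›⟩ := hhead
      rw [h0]
      exact ⟨s, hs, hsx⟩
    | succ i ih =>
      obtain ⟨u, hu, hux⟩ := ih
      haveI := (c i.castSucc).2
      haveI := (c i.succ).2
      have hcov : (⟨(c i.castSucc).asIdeal, (c i.castSucc).2⟩ : PrimeSpectrum R) ⋖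
          ⟨(c i.succ).asIdeal, (c i.succ).2⟩ := hsat i
      exact exists_mul_mem_pow_of_covBy hcov hu hux
  obtain ⟨u, hu, hux⟩ := key (Fin.last _)
  have hl : c (Fin.last _) = ⟨maximalIdeal R, inferInstance⟩ := hlast
  rw [hl] at hu hux
  change u ∉ maximalIdeal R at hu
  have hunit : IsUnit u := by rwa [mem_maximalIdeal, mem_nonunits_iff, not_not] at hu
  exact (Ideal.unit_mul_mem_iff_mem _ hunit).mp hux

/-- **Generization lowers the order**, localization form: if `S` is the localization of the regular
local ring `R` at a prime `P` and `x/1 ∈ (PS)ⁿ`, then `x ∈ 𝔪ⁿ`; for ideals, `JS ⊆ (PS)ⁿ ⇒ J ⊆ 𝔪ⁿ`,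
i.e. `ord_P J ≤ ord_𝔪 J`. [cite: CossartPiltant2008, Prop. 4.2 (proof)] -/
theorem mem_pow_of_algebraMap_mem_pow {R : Type u} [CommRing R] [IsRegularLocalRing R]
    (P : Ideal R) [P.IsPrime] (S : Type*) [CommRing S] [Algebra R S] [IsLocalization.AtPrime S P]
    [IsLocalRing S] {n : ℕ} {x : R} (hx : algebraMap R S x ∈ maximalIdeal S ^ n) :
    x ∈ maximalIdeal R ^ n := by
  haveI : IsDomain R := isDomain_of_isRegularLocalRing R
  obtain ⟨s, hs, hsx⟩ := exists_mul_mem_pow_of_algebraMap_mem_maximalIdeal_pow P S hx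
  exact mem_pow_of_mul_mem_pow P hs hsx

/-- Ideal form: `J S ⊆ (P S)ⁿ ⇒ J ⊆ 𝔪ⁿ`. [cite: CossartPiltant2008, Prop. 4.2 (proof)] -/
theorem le_pow_of_map_le_pow {R : Type u} [CommRing R] [IsRegularLocalRing R] (P : Ideal R)
    [P.IsPrime] (S : Type*) [CommRing S] [Algebra R S] [IsLocalization.AtPrime S P] [IsLocalRing S]
    {n : ℕ} {J : Ideal R} (hJ : J.map (algebraMap R S) ≤ maximalIdeal S ^ n) :
    J ≤ maximalIdeal R ^ n := fun _ hx =>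
  mem_pow_of_algebraMap_mem_pow P S (hJ (Ideal.mem_map_of_mem _ hx))

end Literature.AlgebraicGeometry.Resolution

end
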